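import Literature.NumberTheory.Automorphic.GLnTwoBlockUnipotentHaarTransport
import HarnessLib

/-!
# `Ad` on the box of a two-block parabolic of `GL_n(F)` is a homomorphism (`K_{pq} = K_p K_q`,
# `det K_{mpm⁻¹} = det K_p`, `det(1 - K_{mpm⁻¹}) = det(1 - K_p)`), and the `ℝ≥0∞` product-integral
# substitutions on `X × U_c`

Topic `NumberTheory/Automorphic`; namespace `Literature.NumberTheory.Automorphic`. KERNEL
mathematics only: theorems, no definition, no named fact, no instance, no `sorry`. Road «D-S1»,
letter D-S1c (Rogawski 1990, Lemma 4.13.1 (a), proof p. 70), algebraic and `lintegral` preliminaries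
for the regular descent `GLnLeviOrbitalDescent`: `P_c = M_c U_c` a two-block parabolic
(`c : n → Bool`), `K_p` the matrix of `Ad(p)` on the box `𝔲 ≅ R^{I × J}`
(`(K_p)_{(i,j),(i',j')} = p_{i i'} (p⁻¹)_{j' j}`, `parabolic_conj_boxChart`).

* §1 `boxAd_one`, `boxAd_mul` — `K_1 = 1`, **`K_{pq} = K_p K_q`** (any topological commutative ring;
  `(pq) Φ(x) (pq)⁻¹ = p (q Φ(x) q⁻¹) p⁻¹` and injectivity of the box chart);
  `det_boxAd_conj_eq`, `det_one_sub_boxAd_conj_eq` — **`det K_{m p m⁻¹} = det K_p`,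
  `det(1 - K_{m p m⁻¹}) = det(1 - K_p)`** (the Jacobians of the descent are class functions on `M`).
* §2 `lintegral_prod_unipotent_conj_eq_mul`,
  `lintegral_prod_unipotent_mul_parabolic_eq_mul` — the `ℝ≥0∞` twins of
  `integral_prod_unipotent_conj_eq_smul` / `integral_prod_unipotent_mul_parabolic_eq_smul`
  (`GLnTwoBlockUnipotentHaarTransport`): for EVERY `G : GL_n(F) → [0, ∞]`,
  **`∫⁻_{X × U_c} G(g u p u⁻¹ g⁻¹) = ‖det(1 - K_p)‖⁻¹ ∫⁻ G(g (u p) g⁻¹)`**,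
  **`∫⁻_{X × U_c} G(g (u p) g⁻¹) = ‖det K_p‖ ∫⁻ G(g (p u) g⁻¹)`** (`lintegral_map_equiv` along `id × T`).

## References

* [Rogawski1990] J. D. Rogawski, *Automorphic Representations of Unitary Groups in Three Variables*,
  Ann. of Math. Stud. 123 (1990), §4.13, Lemma 4.13.1 (a) and proof, pp. 69–70.
* [BernsteinZelevinsky1977] I. N. Bernstein, A. V. Zelevinsky, Ann. Sci. ÉNS 10 (1977), 1.7, §2.1.
-/

noncomputable section

open scoped MatrixGroups NNReal ENNReal
open MeasureTheory Measure Matrix Topology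

namespace Literature.NumberTheory.Automorphic

open Literature.MeasureTheory.Group
open Literature.NumberTheory.GaloisRepresentations.IsNonarchimedeanLocalField

/-! ### 1. `Ad` on the box is a homomorphism: `K_1 = 1`, `K_{pq} = K_p K_q` -/

section BoxAd

variable {R : Type*} [CommRing R] [TopologicalSpace R] [IsTopologicalRing R]
  {n : Type*} [Fintype n] [DecidableEq n] {c : n → Bool}

omit [TopologicalSpace R] [IsTopologicalRing R] in
/-- `K_1 = 1`: the adjoint action of `1 ∈ P_c` on the box is the identity. [cite: BernsteinZelevinsky1977, §2.1] -/
theorem boxAd_one :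
    (Matrix.of fun q q' : {i : n // c i = false} × {j : n // c j = true} =>
        (((1 : standardParabolicGL R c) : GL n R) : Matrix n n R) q.1 q'.1 *
          ((((1 : standardParabolicGL R c)⁻¹ : standardParabolicGL R c) : GL n R) : Matrix n n R)
            q'.2 q.2) = 1 := by
  ext q q'
  simp only [inv_one, OneMemClass.coe_one, Units.val_one, Matrix.of_apply, Matrix.one_apply]
  by_cases h : q = q'
  · subst h; simp
  · rw [if_neg h]
    by_cases h1 : (q.1 : n) = q'.1
    · have h2 : (q'.2 : n) ≠ q.2 := fun h2 => h (Prod.ext (Subtype.ext h1) (Subtype.ext h2.symm))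
      rw [if_neg h2, mul_zero]
    · rw [if_neg h1, zero_mul]

/-- **`K_{pq} = K_p K_q`**: `p ↦ K_p`, the matrix of `Ad(p)` on the box, is a homomorphism on `P_c`
(`(pq) Φ(x) (pq)⁻¹ = p (q Φ(x) q⁻¹) p⁻¹`, `parabolic_conj_boxChart`, injectivity of the box chart).
[cite: BernsteinZelevinsky1977, §2.1] -/
theorem boxAd_mul (p p' : standardParabolicGL R c) :
    (Matrix.of fun q q' : {i : n // c i = false} × {j : n // c j = true} =>
        (((p * p' : standardParabolicGL R c) : GL n R) : Matrix n n R) q.1 q'.1 *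
          ((((p * p')⁻¹ : standardParabolicGL R c) : GL n R) : Matrix n n R) q'.2 q.2) =
      (Matrix.of fun q q' : {i : n // c i = false} × {j : n // c j = true} =>
        ((p : GL n R) : Matrix n n R) q.1 q'.1 *
          (((p⁻¹ : standardParabolicGL R c) : GL n R) : Matrix n n R) q'.2 q.2) *
      (Matrix.of fun q q' : {i : n // c i = false} × {j : n // c j = true} =>
        ((p' : GL n R) : Matrix n n R) q.1 q'.1 *
          (((p'⁻¹ : standardParabolicGL R c) : GL n R) : Matrix n n R) q'.2 q.2) := by
  classical
  obtain ⟨Φ, hΦ, -, -⟩ := exists_boxHomeomorph_unipotentRadicalP R c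
  have hpp := fun x => parabolic_conj_boxChart (Φ : _ → ↥(unipotentRadicalP R c)) hΦ (p * p') x
  have hp := fun x => parabolic_conj_boxChart (Φ : _ → ↥(unipotentRadicalP R c)) hΦ p x
  have hp' := fun x => parabolic_conj_boxChart (Φ : _ → ↥(unipotentRadicalP R c)) hΦ p' x
  generalize (Matrix.of fun q q' : {i : n // c i = false} × {j : n // c j = true} =>
      (((p * p' : standardParabolicGL R c) : GL n R) : Matrix n n R) q.1 q'.1 *
        ((((p * p')⁻¹ : standardParabolicGL R c) : GL n R) : Matrix n n R) q'.2 q.2) = Kpp at hpp ⊢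
  generalize (Matrix.of fun q q' : {i : n // c i = false} × {j : n // c j = true} =>
      ((p : GL n R) : Matrix n n R) q.1 q'.1 *
        (((p⁻¹ : standardParabolicGL R c) : GL n R) : Matrix n n R) q'.2 q.2) = Kp at hp ⊢
  generalize (Matrix.of fun q q' : {i : n // c i = false} × {j : n // c j = true} =>
      ((p' : GL n R) : Matrix n n R) q.1 q'.1 *
        (((p'⁻¹ : standardParabolicGL R c) : GL n R) : Matrix n n R) q'.2 q.2) = Kp' at hp' ⊢
  apply (Matrix.toLin' (R := R)).injective
  rw [Matrix.toLin'_mul]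
  refine LinearMap.ext fun x => Φ.injective (Subtype.ext ?_)
  rw [LinearMap.comp_apply, ← hpp x, ← hp, ← hp']
  group

/-- **`det K_{m p m⁻¹} = det K_p`** (`K_{m p m⁻¹} = K_m K_p K_{m⁻¹}`, `det K_m det K_{m⁻¹} = 1`).
[cite: BernsteinZelevinsky1977, §2.1] -/
theorem det_boxAd_conj_eq {F : Type*} [Field F] [ValuativeRel F] [TopologicalSpace F]
    [IsNonarchimedeanLocalField F] {c : n → Bool} (m p : standardParabolicGL F c) :
    (Matrix.of fun q q' : {i : n // c i = false} × {j : n // c j = true} =>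
        (((m * p * m⁻¹ : standardParabolicGL F c) : GL n F) : Matrix n n F) q.1 q'.1 *
          ((((m * p * m⁻¹)⁻¹ : standardParabolicGL F c) : GL n F) : Matrix n n F) q'.2 q.2).det =
      (Matrix.of fun q q' : {i : n // c i = false} × {j : n // c j = true} =>
        ((p : GL n F) : Matrix n n F) q.1 q'.1 *
          (((p⁻¹ : standardParabolicGL F c) : GL n F) : Matrix n n F) q'.2 q.2).det := by
  have hT : IsTopologicalRing F := inferInstance
  have h := det_boxAd_mul_det_boxAd_inv m
  rw [boxAd_mul, boxAd_mul, inv_inv, Matrix.det_mul, Matrix.det_mul, mul_right_comm, h, one_mul]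

/-- **`det(1 - K_{m p m⁻¹}) = det(1 - K_p)`** (`1 - K_{m p m⁻¹} = K_m (1 - K_p) K_{m⁻¹}`,
`K_m K_{m⁻¹} = K_1 = 1`). [cite: Rogawski1990, §4.13, proof of Lemma 4.13.1, p. 70] -/
theorem det_one_sub_boxAd_conj_eq {F : Type*} [Field F] [ValuativeRel F] [TopologicalSpace F]
    [IsNonarchimedeanLocalField F] {c : n → Bool} (m p : standardParabolicGL F c) :
    (1 - Matrix.of fun q q' : {i : n // c i = false} × {j : n // c j = true} =>
        (((m * p * m⁻¹ : standardParabolicGL F c) : GL n F) : Matrix n n F) q.1 q'.1 *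
          ((((m * p * m⁻¹)⁻¹ : standardParabolicGL F c) : GL n F) : Matrix n n F) q'.2 q.2).det =
      (1 - Matrix.of fun q q' : {i : n // c i = false} × {j : n // c j = true} =>
        ((p : GL n F) : Matrix n n F) q.1 q'.1 *
          (((p⁻¹ : standardParabolicGL F c) : GL n F) : Matrix n n F) q'.2 q.2).det := by
  have hT : IsTopologicalRing F := inferInstance
  have h1 : (Matrix.of fun q q' : {i : n // c i = false} × {j : n // c j = true} =>
      ((m : GL n F) : Matrix n n F) q.1 q'.1 *
        (((m⁻¹ : standardParabolicGL F c) : GL n F) : Matrix n n F) q'.2 q.2) *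
      (Matrix.of fun q q' : {i : n // c i = false} × {j : n // c j = true} =>
        (((m⁻¹ : standardParabolicGL F c) : GL n F) : Matrix n n F) q.1 q'.1 *
          ((((m⁻¹)⁻¹ : standardParabolicGL F c) : GL n F) : Matrix n n F) q'.2 q.2) = 1 := by
    rw [← boxAd_mul, ← boxAd_one (R := F) (c := c)]
    simp only [mul_inv_cancel]
  rw [boxAd_mul, boxAd_mul]
  generalize (Matrix.of fun q q' : {i : n // c i = false} × {j : n // c j = true} =>
      ((m : GL n F) : Matrix n n F) q.1 q'.1 *
        (((m⁻¹ : standardParabolicGL F c) : GL n F) : Matrix n n F) q'.2 q.2) = Km at h1 ⊢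
  generalize (Matrix.of fun q q' : {i : n // c i = false} × {j : n // c j = true} =>
      (((m⁻¹ : standardParabolicGL F c) : GL n F) : Matrix n n F) q.1 q'.1 *
        ((((m⁻¹)⁻¹ : standardParabolicGL F c) : GL n F) : Matrix n n F) q'.2 q.2) = Km' at h1 ⊢
  generalize (Matrix.of fun q q' : {i : n // c i = false} × {j : n // c j = true} =>
      ((p : GL n F) : Matrix n n F) q.1 q'.1 *
        (((p⁻¹ : standardParabolicGL F c) : GL n F) : Matrix n n F) q'.2 q.2) = Kp
  have hexp : 1 - Km * Kp * Km' = Km * (1 - Kp) * Km' := by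
    rw [Matrix.mul_sub, Matrix.sub_mul, Matrix.mul_one, h1]
  rw [hexp, Matrix.det_mul, Matrix.det_mul, mul_right_comm, ← Matrix.det_mul, h1, Matrix.det_one,
    one_mul]

end BoxAd

/-! ### 2. The substitutions on `X × U_c`, `ℝ≥0∞` version -/

section LIntegral

variable {F : Type*} [Field F] [ValuativeRel F] [TopologicalSpace F] [IsNonarchimedeanLocalField F]
  [MeasurableSpace F] [BorelSpace F]
  {n : Type*} [Fintype n] [DecidableEq n] {c : n → Bool}

omit [ValuativeRel F] [IsNonarchimedeanLocalField F] [MeasurableSpace F] [BorelSpace F] in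
/-- Transport of a product `lintegral` along `id × T` for a homeomorphism `T` of `U_c(F)` scaling the
measure by `J`: `∫⁻ G(x, T u) = J ∫⁻ G` (`lintegral_map_equiv`). [folklore] -/
private theorem lintegral_prod_comp_homeomorph_eq_mul {X : Type*} [MeasurableSpace X]
    (κ : Measure X) [SFinite κ]
    [MeasurableSpace ↥(unipotentRadicalGL F c)] [BorelSpace ↥(unipotentRadicalGL F c)]
    (ν : Measure ↥(unipotentRadicalGL F c)) [SFinite ν]
    (T : ↥(unipotentRadicalGL F c) ≃ₜ ↥(unipotentRadicalGL F c)) {J : ℝ≥0}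
    (hTν : Measure.map T ν = (J : ℝ≥0∞) • ν) (G : X × ↥(unipotentRadicalGL F c) → ℝ≥0∞) :
    ∫⁻ q, G (q.1, T q.2) ∂(κ.prod ν) = (J : ℝ≥0∞) * ∫⁻ q, G q ∂(κ.prod ν) := by
  set Ψ : X × ↥(unipotentRadicalGL F c) ≃ᵐ X × ↥(unipotentRadicalGL F c) :=
    (MeasurableEquiv.refl X).prodCongr T.toMeasurableEquiv with hΨdef
  have hΨ : Measure.map Ψ (κ.prod ν) = (J : ℝ≥0∞) • κ.prod ν := by
    rw [show (Ψ : X × ↥(unipotentRadicalGL F c) → _) = Prod.map id T from funext fun q => rfl,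
      ← Measure.map_prod_map κ ν measurable_id T.continuous.measurable, Measure.map_id, hTν,
      Measure.prod_smul_right]
  have key := lintegral_map_equiv G Ψ (μ := κ.prod ν)
  rw [hΨ, lintegral_smul_measure, smul_eq_mul] at key
  exact key.symm

omit [MeasurableSpace F] [BorelSpace F] in
/-- A Haar measure on `U_c(F) ≅ F^{I × J}` is s-finite. [folklore] -/
private theorem sFinite_haar_unipotentRadicalGL
    [MeasurableSpace ↥(unipotentRadicalGL F c)] [BorelSpace ↥(unipotentRadicalGL F c)]
    (ν : Measure ↥(unipotentRadicalGL F c)) [IsHaarMeasure ν] : SFinite ν := by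
  haveI : T2Space F := (isLocalField F).toT2Space
  haveI : SecondCountableTopology F := secondCountableTopology_localField F
  haveI : LocallyCompactSpace F := (isLocalField F).toLocallyCompactSpace
  obtain ⟨Φ, -, -⟩ := exists_boxHomeomorph_unipotentRadicalGL (R := F) c
  haveI := Φ.symm.isClosedEmbedding.locallyCompactSpace
  haveI := Φ.symm.secondCountableTopology
  infer_instance

/-- **`∫⁻_{X × U_c} G(g(x) u p u⁻¹ g(x)⁻¹) = ‖det(1 - K_p)‖_F⁻¹ ∫⁻_{X × U_c} G(g(x) (u p) g(x)⁻¹)`** for EVERY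
`G : GL_n(F) → [0, ∞]` (`exists_homeomorph_unipotentRadicalGL_conj_eq`, `lintegral_map_equiv`).
[cite: Rogawski1990, §4.13, proof of Lemma 4.13.1, p. 70] -/
theorem lintegral_prod_unipotent_conj_eq_mul {X : Type*} [MeasurableSpace X] (κ : Measure X)
    [SFinite κ] (g : X → GL n F)
    [MeasurableSpace ↥(unipotentRadicalGL F c)] [BorelSpace ↥(unipotentRadicalGL F c)]
    (ν : Measure ↥(unipotentRadicalGL F c)) [IsHaarMeasure ν] (p : standardParabolicGL F c)
    (hp : (1 - Matrix.of fun q q' : {i : n // c i = false} × {j : n // c j = true} =>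
          ((p : GL n F) : Matrix n n F) q.1 q'.1 *
            (((p⁻¹ : standardParabolicGL F c) : GL n F) : Matrix n n F) q'.2 q.2).det ≠ 0)
    (G : GL n F → ℝ≥0∞) :
    ∫⁻ q : X × ↥(unipotentRadicalGL F c),
        G (g q.1 * (q.2 : GL n F) * (p : GL n F) * (g q.1 * (q.2 : GL n F))⁻¹) ∂(κ.prod ν) =
      ((normAbs F ((1 - Matrix.of fun q q' : {i : n // c i = false} × {j : n // c j = true} =>
          ((p : GL n F) : Matrix n n F) q.1 q'.1 *
            (((p⁻¹ : standardParabolicGL F c) : GL n F) : Matrix n n F) q'.2 q.2).det)⁻¹ :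
          ℝ≥0) : ℝ≥0∞) *
        ∫⁻ q : X × ↥(unipotentRadicalGL F c),
          G (g q.1 * ((q.2 : GL n F) * (p : GL n F)) * (g q.1)⁻¹) ∂(κ.prod ν) := by
  haveI : SFinite ν := sFinite_haar_unipotentRadicalGL ν
  obtain ⟨T, hT, hTν⟩ := exists_homeomorph_unipotentRadicalGL_conj_eq ν p hp
  rw [← lintegral_prod_comp_homeomorph_eq_mul κ ν T hTν]
  refine lintegral_congr fun q => ?_
  simp only
  rw [← hT q.2, _root_.mul_inv_rev, ← mul_assoc, mul_assoc (g q.1), mul_assoc (g q.1),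
    mul_assoc (q.2 : GL n F)]

/-- **`∫⁻_{X × U_c} G(g(x) (u p) g(x)⁻¹) = ‖det K_p‖_F ∫⁻_{X × U_c} G(g(x) (p u) g(x)⁻¹)`** for EVERY
`G : GL_n(F) → [0, ∞]` (`exists_homeomorph_unipotentRadicalGL_parabolic_conj` at `p⁻¹`).
[cite: Rogawski1990, §4.13, proof of Lemma 4.13.1, p. 70] -/
theorem lintegral_prod_unipotent_mul_parabolic_eq_mul {X : Type*} [MeasurableSpace X] (κ : Measure X)
    [SFinite κ] (g : X → GL n F)
    [MeasurableSpace ↥(unipotentRadicalGL F c)] [BorelSpace ↥(unipotentRadicalGL F c)]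
    (ν : Measure ↥(unipotentRadicalGL F c)) [IsHaarMeasure ν] (p : standardParabolicGL F c)
    (G : GL n F → ℝ≥0∞) :
    ∫⁻ q : X × ↥(unipotentRadicalGL F c),
        G (g q.1 * ((q.2 : GL n F) * (p : GL n F)) * (g q.1)⁻¹) ∂(κ.prod ν) =
      ((normAbs F (Matrix.of fun q q' : {i : n // c i = false} × {j : n // c j = true} =>
          ((p : GL n F) : Matrix n n F) q.1 q'.1 *
            (((p⁻¹ : standardParabolicGL F c) : GL n F) : Matrix n n F) q'.2 q.2).det : ℝ≥0) : ℝ≥0∞) *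
        ∫⁻ q : X × ↥(unipotentRadicalGL F c),
          G (g q.1 * ((p : GL n F) * (q.2 : GL n F)) * (g q.1)⁻¹) ∂(κ.prod ν) := by
  haveI : SFinite ν := sFinite_haar_unipotentRadicalGL ν
  obtain ⟨T, hT, -, hTν⟩ := exists_homeomorph_unipotentRadicalGL_parabolic_conj ν p⁻¹
  have hdet := det_boxAd_mul_det_boxAd_inv p
  simp only [inv_inv] at hT hTν
  generalize (Matrix.of fun q q' : {i : n // c i = false} × {j : n // c j = true} =>
      ((p : GL n F) : Matrix n n F) q.1 q'.1 *
        (((p⁻¹ : standardParabolicGL F c) : GL n F) : Matrix n n F) q'.2 q.2) = K at hdet ⊢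
  generalize (Matrix.of fun q q' : {i : n // c i = false} × {j : n // c j = true} =>
      (((p⁻¹ : standardParabolicGL F c) : GL n F) : Matrix n n F) q.1 q'.1 *
        ((p : GL n F) : Matrix n n F) q'.2 q.2) = K' at hdet hTν
  have hK' : (K'.det)⁻¹ = K.det := by
    rw [← mul_eq_one_iff_inv_eq₀ (fun h0 => by simp [h0] at hdet), mul_comm, hdet]
  rw [hK'] at hTν
  rw [← lintegral_prod_comp_homeomorph_eq_mul κ ν T hTν]
  refine lintegral_congr fun q => ?_
  have hgrp : (p : GL n F) * ((p : GL n F)⁻¹ * (q.2 : GL n F) * (p : GL n F)) =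
      (q.2 : GL n F) * (p : GL n F) := by group
  simp only
  rw [hT q.2, Subgroup.coe_inv, inv_inv, hgrp]

end LIntegral

end Literature.NumberTheory.Automorphic
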